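import Mathlib
import HarnessLib
import HarnessLib.Audit
import Summits.KontsevichZagierPeriods.Statement
import HarnessLib.Audit.Status.Attr

/-!
Route: HurwitzMicroSectors

DORMANT since 2026-08-24T10:50:40Z (reconciler: no traction for 6.7 d (last activity item-evidence-added at 2026-08-17T17:01:57Z); parked, not closed — `ledger route dormant route-KontsevichZagierPeriods-HurwitzMicroSectors --off` to re) — unstaffed, not closed; items shared with open routes are served there. `ledger route dormant <id> --off` reactivates.

# Route HurwitzMicroSectors — dilations are the Hurwitz distribution relations; CDT 2024 closes
Conjecture 1 on the level-6 box sector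

X = NORMAL-FORM PRINCIPLE (the reduction–rigidity form of Conjecture 1, card
cdt-weight-two-micro-sectors): there is a family 𝒩 of
"normal-form" integral representations on which the value map is injective up to KZ-equivalence
(RIGIDITY) and to which every rational
representation reduces by moves (REDUCTION). Honesty clause: X is equivalent to the statement (take
𝒩 = all rational reps; both
directions are proved in the folder's Sketch.lean), so X itself restates the target; the CONTENT of
the route is the explicit
sub-families of 𝒩 on which both halves are theorems NOW — the (weight, level) MICRO-SECTORS 𝒞_(w,N)
of box integrals
∫_(0,1)^w P(t)/(1−t^N), t = x₁⋯x_w, P ∈ ℚ[t], whose values are ℚ-combinations of Hurwitz values ζ(w,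
j/N): reduction = the dilations
x_i ↦ x_i^m (ONE change-of-variables move each: they ARE the distribution relations) + partial
fractions + polynomial Newton–Leibniz;
rigidity = a linear-independence THEOREM: (2,6) ⟸ Calegari–Dimitrov–Tang 2024 (1, π², L(2,χ₋₃)
ℚ-independent), (3,2) ⟸ Apéry
(proved in tree), (2,4) ⟸ the open independence of 1, π², G (Catalan) — filed conditionally.
Lean: `∃ 𝒩 : (n : ℕ) → Set (Literature.NumberTheory.Transcendental.KZ.IntegralRep n), (∀ (n m : ℕ)
(N : Literature.NumberTheory.Transcendental.KZ.IntegralRep n) (N' :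
Literature.NumberTheory.Transcendental.KZ.IntegralRep m), N ∈ 𝒩 n → N' ∈ 𝒩 m → N.value = N'.value →
Literature.NumberTheory.Transcendental.KZ.Equivalent N N') ∧ (∀ (n : ℕ) (r :
Literature.NumberTheory.Transcendental.KZ.IntegralRep n), r.IsRational → ∃ (m : ℕ) (N :
Literature.NumberTheory.Transcendental.KZ.IntegralRep m), N ∈ 𝒩 m ∧
Literature.NumberTheory.Transcendental.KZ.Equivalent r N)`

## Assembly
Pure logic plus soundness of the calculus: given 𝒩, two rational reps r, r' with equal values reduce
to N, N' ∈ 𝒩 (reduction); by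
`Literature.NumberTheory.Transcendental.KZ.Equivalent.value_eq_holds` N and N' have the values of r
and r', hence equal values, hence
are equivalent (rigidity); compose r ∼ N ∼ N' ∼ r'. PROVED in the folder's Sketch.lean
(assembly_holds, 10 lines, via
KontsevichZagierPeriods_iff); a prover can copy it verbatim. The sector cruxes are the instances of
the target on explicit sub-families
(they are evidence for X, not antecedents of the assembly); SectorTwoSix ⇐ ReductionTwoSix →
RigidityTwoSix → SectorTwoSix is also
proved in Sketch.lean (sectorTwoSix_of, with the reusable helper equivalent_of_eqOn: same domain +
integrands agreeing on it ⇒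
equivalent by one additivity move against the zero rep).

Rationale: WHY THIS LINE. Reduce-then-rigidity is the only mechanism that has ever CLOSED a sector of
Conjecture 1 for a fixed calculus (route LowDimension: d ≤ 1 via
Baker), and its reach is exactly the reach of transcendence theory; CalegariDimitrovTang2024 Thm 1
(arXiv:2408.15403, arithmetic holonomy
bounds — a method outside the Baker/Wüstholz/Siegel families used so far on this summit) is the
first new linear-independence theorem in
decades about periods beyond 1-motives, and its three periods 1, π², L(2,χ₋₃) are precisely the
values of the level-6 weight-2 box
sector (CDT Cor. 2: ζ(2, n/6) ∈ ℚπ² + ℚL). On the rules side the distribution (Kubert) relations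
among ζ(w, j/N) (Milnor1983; Lang1990
Ch. 2 §8–10) are literally the substitutions x ↦ x^m on the unit box with polynomial Jacobian m^w
t^(m−1), so the whole move-content of
a micro-sector is "raise the variables to a power" and what remains is pure transcendence input.
Imported: transcendence / arithmetic
holonomy (CDT), cyclotomic distribution theory (Kubert–Lang–Milnor); no spectral, probabilistic or
physical reformulation applies.
What it does that prior routes do not: the first weight-two, non-torsion, non-1-motivic COMPLETE
sector of the H21 calculus, typable
today over KZCalculus with a 2024 theorem as its only non-elementary input, plus a rung table
turning Catalan / ζ(3)-vs-π³√3 into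
syntactic independence statements in P_KZ; negatives index empty at filing.

RANKED CRUXES. #0 NormalFormPrinciple (target) — there is a family 𝒩 = (𝒩 n ⊆ IntegralRep n) such
that (rigidity) N ∈ 𝒩 n, N' ∈ 𝒩 m with equal values are KZ-equivalent and (reduction) every rational
rep is KZ-equivalent to a member of 𝒩. Equivalent to the statement (Sketch.lean: both directions
sorry-free); the route's work is the explicit sub-families below. (why it might fail:
summit-strength (take 𝒩 = rational reps): false iff Conjecture 1 for the fixed H21 calculus is false
— route Neg's bets (Γ-detours, regularised MZV relations, transcendental primitives) are exactly the
candidate failures.) [KontsevichZagier2001, HuberMullerStach2017, CalegariDimitrovTang2024]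
#2 SectorTwoSix (crux) — (card N3) CDT's Theorem 1 — 1, π², L(2,χ₋₃) = Σ_(n≥0)(1/(3n+1)² −
1/(3n+2)²) are ℚ-linearly independent, entered as an explicit hypothesis (no Literature fact yet;
cite item filed) — implies Conjecture 1 for every pair of reps on the open box (0,1)² with
integrands P(xy)/(1−(xy)⁶), P'(xy)/(1−(xy)⁶), P, P' ∈ ℚ[t]: equal values ⇒ KZ-equivalent. Glue of
ReductionTwoSix + RigidityTwoSix (proved in Sketch.lean: sectorTwoSix_of). [deps: ReductionTwoSix,
RigidityTwoSix] [difficulty: L] (why it might fail: no division rule: chains live in the ℤ-span of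
moves, so rational rescalings must sit inside integrands; if one of the 4 level-6 relations (H2=3H5,
H0+H3=4H1, H0+H2+H4=9H2, H1+H3+H5=9H5) is not realisable by Dil₂, Dil₃ + additivity, equal-valued
reps keep distinct normal forms.) [CalegariDimitrovTang2024, KontsevichZagier2001, Milnor1983,
Lang1990]
#3 ReductionTwoSix (crux) — (card N2) every rep on the open box (0,1)² with integrand
P(xy)/(1−(xy)⁶) on it, P ∈ ℚ[t], is KZ-equivalent to a NORMAL FORM: a rep on the same box with
integrand a + b/(1−xy) + c/(1+xy+x²y²) for some a, b, c ∈ ℚ. Route: partial fractions into Σ_r p_r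
t^r/(1−t⁶) + polynomial (integrand additivity); the four distribution relations from DilationMove
with m = 2 (level 3 → 6: H_r+H_(r+3) ∼ 4H_(2r+1)) and m = 3 (level 2 → 6: H_r+H_(r+2)+H_(r+4) ∼
9H_(3r+2)) reduce Σ p_r H_r to αH₃ + βH₅; the basis integrands are 1/(1−t) ∼ 36H₅ and 1/(1+t+t²) =
(1−t+t³−t⁴)/(1−t⁶) ∼ 32H₅ − 8H₃ (so c = −α/8, b = (β+4α)/36); polynomial parts t^k ∼ constant
1/(k+1)² by Newton–Leibniz twice down to a point and twice back (polynomial primitives), null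
boundary faces by domain additivity. All relations verified numerically to 1e−14 (folder NOTES.md).
[deps: DilationMove, BoxIntegralZetaTwo] [difficulty: L] (why it might fail: as typed the ∃ r' needs
IntegrableOn of 1/(1−xy) on the box (true: ζ(2)) and every intermediate rep integrable and
ℚ-semialgebraic; mathematically it fails only if a ℚ-relation among H₀…H₅ used by the normal form is
NOT generated by the m = 2, 3 dilations (rank count: 4 of 4 are).) [Milnor1983, Lang1990,
KontsevichZagier2001, CalegariDimitrovTang2024]
#4 DilationMove (crux) — (card N1, the engine, any dimension n, any m ≥ 1) for reps r, r' on the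
open unit box (0,1)ⁿ with r.integrand x = r'.integrand (x_i^m)_i · m^n ∏_i x_i^(m−1) on the box, [r]
− [r'] is ONE change-of-variables move (Φ x = (x_i^m)_i: polynomial hence ℚ-semialgebraic, injective
with image the box, derivative diag(m x_i^(m−1)) with determinant m^n ∏ x_i^(m−1) > 0). This
realises every Hurwitz distribution relation Σ_(j<m) ζ(w,(a+j)/m)-type identity inside rule 2).
[difficulty: M] (why it might fail: only as typed: r'.domain = Φ '' r.domain needs Φ''(0,1)ⁿ =
(0,1)ⁿ exactly, the Fréchet derivative within the box must be the diagonal CLM whose `.det` is m^n ∏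
x_i^(m−1) (truncated `m - 1`, m = 1 ⇒ identity), and |det| = det needs positivity on the open box.)
[KontsevichZagier2001, Milnor1983, BCR1998]
#5 AperySectorThreeTwo (crux) — (card N4, weight-3 calibration, UNCONDITIONAL) Conjecture 1 holds
for every pair of reps on the open box (0,1)³ with integrands P(xyz)/(1−(xyz)²), P'(xyz)/(1−(xyz)²),
P, P' ∈ ℚ[t]: values lie in ℚ + ℚζ(3) (h₀ = Σ1/(2j+1)³ = 7ζ(3)/8, h₁ = ζ(3)/8), normal forms a +
b/(1−xyz); reduction = ONE dilation (m = 2, n = 3: [1/(1−t)] ∼ [8t/(1−t²)], i.e. H₀ + H₁ ∼ 8H₁) +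
polynomial parts; rigidity = ζ(3) ∉ ℚ, which is PROVED in tree
(Literature.NumberTheory.Transcendental.irrational_zetaValue_three_holds), so no hypothesis is
carried. [deps: DilationMove] [difficulty: L] (why it might fail: ∫(0,1)³ 1/(1−xyz) must be
identified with zetaValue 3 = Σ' 1/n³ (tsum from n = 0, junk 1/0 = 0) exactly; polynomial parts
leave dimension 3 (Newton–Leibniz thrice to a point and back) with integrable semialgebraic
intermediates — a side-condition slip falsifies the ∀ as typed.) [Apery1979, KontsevichZagier2001,
Milnor1983, BeukersCalabiKolk1993]
#9 RigidityTwoSix (support) — (card N3, rigidity half) under CDT's Theorem 1, two normal forms a +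
b/(1−xy) + c/(1+xy+x²y²) and a' + b'/(1−xy) + c'/(1+xy+x²y²) on the open box with equal values have
(a,b,c) = (a',b',c'): value = a + bπ²/6 + cL(2,χ₋₃) by BoxIntegralZetaTwo / BoxIntegralLTwoChiThree
(box has volume 1), then linear independence compares coefficients. [difficulty: provable-now]
[CalegariDimitrovTang2024, KontsevichZagier2001]
#9 BoxIntegralZetaTwo (support) — KZ's own example: 1/(1−xy) is integrable on the open unit box and
∫∫ dxdy/(1−xy) = π²/6 (expand the geometric series, Tonelli, Σ 1/(k+1)² = π²/6 via Mathlib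
hasSum_zeta_two). [difficulty: provable-now] [KontsevichZagier2001, BeukersCalabiKolk1993]
#9 BoxIntegralLTwoChiThree (support) — 1/(1+xy+x²y²) = (1−t)/(1−t³) is integrable on the open unit
box and ∫∫ = Σ_(n≥0)(1/(3n+1)² − 1/(3n+2)²) = L(2,χ₋₃) = 0.7813024128964862968… (CDT p. 3 prints the
equivalent ∬_(1≥y≥x≥0) dxdy/(y(1+x+x²))). [difficulty: provable-now] [CalegariDimitrovTang2024,
KontsevichZagier2001]
#9 CatalanSectorTwoFour (support) — (card N4, the next rung, CONDITIONAL on an OPEN hypothesis) if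
1, π², G = Σ(−1)ⁿ/(2n+1)² are ℚ-linearly independent then Conjecture 1 holds on the level-4 weight-2
box sector P(xy)/(1−(xy)⁴): values in ℚ + ℚπ² + ℚG (G = ∫∫dxdy/(1+x²y²) = h₀ − h₂), normal forms a +
b/(1−xy) + c/(1+x²y²), reduction by ONE dilation m = 2 (H₁ ∼ 3H₃, H₀ + H₂ ∼ 12H₃). The implication
is provable now with the same engine; the hypothesis (irrationality of Catalan's constant and more)
is open, which is the card's point: on this rung Conjecture 1 costs exactly Indep(1, π², G).
[difficulty: M] [Milnor1983, Lang1990, KontsevichZagier2001, CalegariDimitrovTang2024]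

TWO-LAYER PLAN. Foreseen glued splits (nothing filed now): SectorTwoSix ⇐ ReductionTwoSix →
RigidityTwoSix → SectorTwoSix (glue proved in Sketch.lean);
ReductionTwoSix ⇐ DistributionBookkeepingTwoSix (Σ p_r H_r ∼ αH₃ + βH₅ by Dil₂, Dil₃) →
PolynomialPartToConstant (t^k ∼ 1/(k+1)² by
Newton–Leibniz twice each way) → ReductionTwoSix; AperySectorThreeTwo ⇐ ReductionThreeTwo →
RigidityThreeTwo (irrational_zetaValue_three_holds)
→ AperySectorThreeTwo. NormalFormPrinciple itself does NOT split into finitely many sectors — the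
rung table is open-ended by design
((4,6) ⟸ Indep(1,π⁴,L(4,χ₋₃)); (3,3) ⟸ Indep(1,ζ(3),π³√3); box → simplex/cone upgrade = multiple
polylogs at roots of unity, cards
linear-reducibility-normal-form / pentagon-*); new rungs are added in tenure only when a sector
closes.

KILL CRITERIA. Refutation of SectorTwoSix's CONCLUSION for one explicit pair (two level-6 box
integrals with equal value, provably not KZ-equivalent)
closes the route (`refuted:SectorTwoSix`) AND is a theorem of route Neg (an additive invariant of
FormalRep separating equal-valued
rational reps) — report to the operator, since the values agree by CDT-independent arithmetic.
Refutation of DilationMove as typed forces a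
restate (domain/derivative side conditions), not a pivot. Refutation of ReductionTwoSix as typed (a
P whose rep has no normal form) with
the mathematics intact ⇒ restate with the missing relation's dilation added; with the mathematics
broken (a fifth relation among H₀…H₅
outside the dilation span) ⇒ pivot the rigidity basis. CDT's theorem being withdrawn would moot
SectorTwoSix (keep AperySectorThreeTwo,
CatalanSectorTwoFour-style conditionals). A proof of KZKernelConjecture elsewhere moots everything
but the calibration value.

NOT DECOMPOSED YET. The general (w, N) sector theorem "Milnor's conjecture at (w, N) + the matching
independence ⇒ Conjecture 1 on 𝒞_(w,N)" (needs a
Literature def of the universal-distribution rank statement, Lang1990 Ch. 2 Thm 9.2/Kubert, and is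
only as good as its open hypotheses);
ℚ̄-coefficient enlargements (regular ideal tetrahedron 3√3·L(2,χ₋₃)/4: NOT covered, CDT is over ℚ
only); the simplex/cone upgrade
(depth > 1 multiple polylogarithms: shuffle chains, Deligne–Goncharov bounds); the converse
"Conjecture 1 on 𝒞_(2,4) ⇒ [1], [1/(1−xy)],
[1/(1+x²y²)] ℤ-independent in FormalRep/relations" (syntactic Catalan) — all layer-2 or separate
cards, deliberately not items now.

CHEAPEST FALSIFIER. (i) A weight-1 / log leak: an element of the (2,6) sector whose value is NOT in
ℚ + ℚπ² + ℚL(2,χ₋₃) — impossible by the residue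
computation (P(t)/(1−t⁶) = poly + Σ_r p_r t^r/(1−t⁶), each piece valued in ℚ·1 ⊕ ℚh_r, and CDT Cor.
2 puts every h_r = Σ_j 1/(6j+r+1)²
in ℚπ² + ℚL; checked numerically: h₀ = 5L/8 + π²/18 to 1e−14). (ii) Rank count of the dilation
relations at level 6: the m = 2, 3
dilations give 5 relations of which exactly 4 are independent (H1+H4 = 4H3 is dependent), matching
dim_ℚ⟨h₀,…,h₅⟩ = 2 — done by hand and
numerically this session, passes. (iii) `lean check` of every signature: Sketch.lean rc 0, 0 sorries
(assembly and glue proved). The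
first thing a refuter should run: typecheck DilationMove's literal membership for n = 2, m = 2
against `changeOfVariablesRel` (the
`.det` of the diagonal CLM).

NUMBERS. L(2,χ₋₃) = 0.7813024128964862968… (CalegariDimitrovTang2024 Thm 1); level-6 residues h_r =
Σ_j (6j+r+1)⁻²: H₂ ∼ 3H₅, H₀ ∼ 32H₅ − 5H₃,
H₁ ∼ 8H₅ − H₃, H₄ ∼ 5H₃ − 8H₅ (all to 1e−14); ζ(2) = 36h₅, L = 32h₅ − 8h₃; CDT Cor. 2: h₀ = 5L/8 +
π²/18, h₄/… as printed p. 3.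
Level 4: H₁ ∼ 3H₃, H₀ + H₂ ∼ 12H₃, G = h₀ − h₂ = 0.9159655941… . Weight 3 level 2: H₀ ∼ 7H₁, h₁ =
ζ(3)/8. Items at open: 10
(1 target, 4 cruxes, 4 support, 1 assembly).

DEFINITION REQUESTS. Cite fact wanted (filed right after open as a `cite` work item):
`Literature.NumberTheory.Transcendental.calegariDimitrovTang_linearIndependent
: LinearIndependent ℚ ![1, π², Σ' n, (1/(3n+1)² − 1/(3n+2)²)]` [CalegariDimitrovTang2024, Thm 1] —
SectorTwoSix / RigidityTwoSix carry
the identical Prop inline, so landing the fact changes nothing in the items (a later restate may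
name it). No new notion is needed:
sectors and normal forms are inlined over KZ.IntegralRep (domain = open box, EqOn integrand).

Novelty: Searches (2026-08-15): `lit frontier KontsevichZagierPeriods --since 2022` (30 rows: odd-zeta
irrationality, MZV/motivic coaction, GPC for
Kummer surfaces — nothing joining CDT to the KZ rules); `lit bridges KontsevichZagierPeriods --cross
any` (30 rows, none relevant);
`lit search --hybrid "Calegari Dimitrov Tang linear independence zeta(2) L(2,chi_-3) arithmetic
holonomy"` (8 book hits, Masser1975 /
Chudnovsky1984 — 1-motivic methods only); `lit search --hybrid "distribution relations Hurwitz zeta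
Kubert identities … Milnor"` (Lang1990
Cyclotomic Fields II Ch. 2 pp. 55–60: universal distribution, Kubert's rank theorem, Rohrlich's
conjecture "a conjecture in the theory of
transcendental numbers", Milnor's Lobachevsky relations); `lit search --source crossref "linear
independence 1 zeta(2) L(2,chi-3) Calegari
Dimitrov Tang"` (doi:10.24033/ast.1206 Fresán Bourbaki 1197; doi:10.1137/25m1806776 CDT ICM 2026);
`lit read arxiv:2408.15403` pp. 1–4
(Thm 1, Cor. 2 read and quoted); `lit galaxy search … --star all` queued-out (service saturated,
logged); openalex budget exhausted;
`ledger negatives` (0); all 9 route files of the sub read (none uses CDT, Hurwitz sectors or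
dilations-as-distributions).
Nearest prior art found: CalegariDimitrovTang2024 (arXiv:2408.15403) Thm 1 + Cor. 2 (the value-level
content of the (2,6) sector, and
L(2,χ₋₃) exhibited "as a period in the sense of Kontsevich–Zagier"); Milnor1983 / Lang1990 Ch. 2
(distribution relations and the
conjecture that they gener  [refs: 10.24033/ast.1206, 10.1137/25m1806776, 2408.15403, doi:10.24033/ast.1206, doi:10.1137/25m1806776, arxiv:2408.15403, Masser1975, Chudnovsky1984, Lang1990, CalegariDimitrovTang2024, Milnor1983]

Barriers (technique_class: reduction-rigidity, linear-independence-input): - technique_class: reduction-rigidity, linear-independence-input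
- Literature.Barriers.KontsevichZagierPeriods.kzConjecture_implies_oddZetaAlgIndep: the strength
barrier is CASHED rung by rung, not evaded — a sector closes exactly when its independence theorem
exists (Lindemann, Apéry, CDT) and is filed conditionally exactly where the barrier's open
consequents live (Catalan; ζ(3) vs π³√3; ζ(5)); no item claims to cross it.
- Literature.Barriers.KontsevichZagierPeriods.kzConjecture_implies_twoPiI_log_algIndep: not engaged
— no logarithms occur (simple poles on |t| = 1 only, values in weight ≥ 2; the weight-1 leak is the
cheapest falsifier (i) and is excluded by the residue computation).
- Literature.Barriers.KontsevichZagierPeriods.kzConjecture_implies_ellipticPeriods_algIndep: not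
engaged — mixed-Tate/cyclotomic values only, no elliptic periods.
- Literature.Barriers.KontsevichZagierPeriods.noSemialgebraicPrimitive_inv_sub_two: evaded — nothing
is integrated out with a transcendental primitive; the only Newton–Leibniz instances have POLYNOMIAL
primitives (monomial parts), the non-trivial relations are rule-2) dilations and rule-1) partial
fractions.
- Literature.Barriers.KontsevichZagierPeriods.cressonViuSos_prop_3_2: not applicable — the line
never asks for one global map between two given representations; dissection/additivity is used
throughout and the maps are the polynomial dilations on a fixed open box.
- Literature.Barriers.KontsevichZagierPeriods.not_complete_of_unde

History (route lifecycle, newest last):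
- 2026-08-16T04:08:32Z · AUTO-CRUX (backfill): NormalFormPrinciple — hypotheses of the deciding theorem that nothing in the route derives are cruxes (operator:999:1085951)
- 2026-08-24T10:50:40Z · DORMANT — reconciler: no traction for 6.7 d (last activity item-evidence-added at 2026-08-17T17:01:57Z); parked, not closed — `ledger route dormant route-KontsevichZagier (operator:999:4093956)

sub-problem: KontsevichZagierPeriods · status: dormant · opened planner-plancard-KontsevichZagierPeriods-Kont-14d8c730-0 2026-08-15T11:25:34Z · rev 3 · ledger route-KontsevichZagierPeriods-HurwitzMicroSectors
GENERATED by the gate from the ledger (D-0016/17). Provers cite these decls: `theorem foo : Summit.KontsevichZagierPeriods.KontsevichZagierPeriods.Theses.HurwitzMicroSectors.<Decl> := …` in Summits/KontsevichZagierPeriods/KontsevichZagierPeriods/Theorems/<Name>.lean.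
-/

namespace Summit.KontsevichZagierPeriods.KontsevichZagierPeriods.Theses.HurwitzMicroSectors

open scoped BigOperators Topology Manifold Classical MeasureTheory ProbabilityTheory Matrix InnerProductSpace ComplexConjugate ContinuousMap
open Filter Set Function TopologicalSpace MeasureTheory

attribute [summit_statement] _root_.KontsevichZagierPeriods

open Literature Periods

/-- item stmt-KontsevichZagierPeriods-3869 · crux (kind.auto-crux: conjecture-grade) · rank 0 · open · by planner
why it might fail: summit-strength (take 𝒩 = rational reps): false iff Conjecture 1 for the fixed H21 calculus is false — route Neg's bets (Γ-detours, regularised MZV relations, transcendental primitives) are exactly the candidate failures.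
sources: KontsevichZagier2001, HuberMullerStach2017, CalegariDimitrovTang2024
[target] there is a family 𝒩 = (𝒩 n ⊆ IntegralRep n) such that (rigidity) N ∈ 𝒩 n, N' ∈ 𝒩 m with
equal values are KZ-equivalent and (reduction) every rational rep is KZ-equivalent to a member of 𝒩.
Equivalent to the statement (Sketch.lean: both directions sorry-free); the route's work is the
explicit sub-families below. -/
@[route_item "route-KontsevichZagierPeriods-HurwitzMicroSectors", crux]
def NormalFormPrinciple : Prop :=
  ∃ 𝒩 : (n : ℕ) → Set (Literature.NumberTheory.Transcendental.KZ.IntegralRep n), (∀ (n m : ℕ) (N : Literature.NumberTheory.Transcendental.KZ.IntegralRep n) (N' : Literature.NumberTheory.Transcendental.KZ.IntegralRep m), N ∈ 𝒩 n → N' ∈ 𝒩 m → N.value = N'.value → Literature.NumberTheory.Transcendental.KZ.Equivalent N N') ∧ (∀ (n : ℕ) (r : Literature.NumberTheory.Transcendental.KZ.IntegralRep n), r.IsRational → ∃ (m : ℕ) (N : Literature.NumberTheory.Transcendental.KZ.IntegralRep m), N ∈ 𝒩 m ∧ Literature.NumberTheory.Transcendental.KZ.Equivalent r N)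

/-- item stmt-KontsevichZagierPeriods-3870 · crux · rank 2 · closed · proved by Summit.KontsevichZagierPeriods.Theorems.HurwitzMicroSectorsSectorTwoSix.SectorTwoSix_of (prover) · by planner
why it might fail: no division rule: chains live in the ℤ-span of moves, so rational rescalings must sit inside integrands; if one of the 4 level-6 relations (H2=3H5, H0+H3=4H1, H0+H2+H4=9H2, H1+H3+H5=9H5) is not realisable by Dil₂, Dil₃ + additivity, equal-valued reps keep distinct normal forms.
sources: CalegariDimitrovTang2024, KontsevichZagier2001, Milnor1983, Lang1990
[crux] (card N3) CDT's Theorem 1 — 1, π², L(2,χ₋₃) = Σ_(n≥0)(1/(3n+1)² − 1/(3n+2)²) are ℚ-linearly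
independent, entered as an explicit hypothesis (no Literature fact yet; cite item filed) — implies
Conjecture 1 for every pair of reps on the open box (0,1)² with integrands P(xy)/(1−(xy)⁶),
P'(xy)/(1−(xy)⁶), P, P' ∈ ℚ[t]: equal values ⇒ KZ-equivalent. Glue of ReductionTwoSix +
RigidityTwoSix (proved in Sketch.lean: sectorTwoSix_of). [deps: ReductionTwoSix, RigidityTwoSix]
[difficulty: L] -/
@[route_item "route-KontsevichZagierPeriods-HurwitzMicroSectors"]
def SectorTwoSix : Prop :=
  LinearIndependent ℚ ![(1 : ℝ), Real.pi ^ 2, (∑' n : ℕ, (1 / (3 * (n : ℝ) + 1) ^ 2 - 1 / (3 * (n : ℝ) + 2) ^ 2))] → ∀ (r r' : Literature.NumberTheory.Transcendental.KZ.IntegralRep 2) (P P' : Polynomial ℚ), r.domain = {x | ∀ i, x i ∈ Set.Ioo (0:ℝ) 1} → r'.domain = {x | ∀ i, x i ∈ Set.Ioo (0:ℝ) 1} → Set.EqOn r.integrand (fun x => Polynomial.aeval (x 0 * x 1) P / (1 - (x 0 * x 1) ^ 6)) r.domain → Set.EqOn r'.integrand (fun x => Polynomial.aeval (x 0 * x 1)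 P' / (1 - (x 0 * x 1) ^ 6)) r'.domain → r.value = r'.value → Literature.NumberTheory.Transcendental.KZ.Equivalent r r'

/-- item stmt-KontsevichZagierPeriods-3871 · crux · rank 3 · closed · proved by Summit.KontsevichZagierPeriods.HurwitzMicroSectors.ReductionTwoSix.reductionTwoSix_proof (prover) · by planner
why it might fail: as typed the ∃ r' needs IntegrableOn of 1/(1−xy) on the box (true: ζ(2)) and every intermediate rep integrable and ℚ-semialgebraic; mathematically it fails only if a ℚ-relation among H₀…H₅ used by the normal form is NOT generated by the m = 2, 3 dilations (rank count: 4 of 4 are).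
sources: Milnor1983, Lang1990, KontsevichZagier2001, CalegariDimitrovTang2024
[crux] (card N2) every rep on the open box (0,1)² with integrand P(xy)/(1−(xy)⁶) on it, P ∈ ℚ[t], is
KZ-equivalent to a NORMAL FORM: a rep on the same box with integrand a + b/(1−xy) + c/(1+xy+x²y²)
for some a, b, c ∈ ℚ. Route: partial fractions into Σ_r p_r t^r/(1−t⁶) + polynomial (integrand
additivity); the four distribution relations from DilationMove with m = 2 (level 3 → 6: H_r+H_(r+3)
∼ 4H_(2r+1)) and m = 3 (level 2 → 6: H_r+H_(r+2)+H_(r+4) ∼ 9H_(3r+2)) reduce Σ p_r H_r to αH₃ + βH₅;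
the basis integrands are 1/(1−t) ∼ 36H₅ and 1/(1+t+t²) = (1−t+t³−t⁴)/(1−t⁶) ∼ 32H₅ − 8H₃ (so c =
−α/8, b = (β+4α)/36); polynomial parts t^k ∼ constant 1/(k+1)² by Newton–Leibniz twice down to a
point and twice back (polynomial primitives), null boundary faces by domain additivity. All
relations verified numerically to 1e−14 (folder NOTES.md). [deps: DilationMove, BoxIntegralZetaTwo]
[difficulty: L] -/
@[route_item "route-KontsevichZagierPeriods-HurwitzMicroSectors"]
def ReductionTwoSix : Prop :=
  ∀ (r : Literature.NumberTheory.Transcendental.KZ.IntegralRep 2) (P : Polynomial ℚ), r.domain = {x | ∀ i, x i ∈ Set.Ioo (0:ℝ) 1} → Set.EqOn r.integrand (fun x => Polynomial.aeval (x 0 * x 1) P / (1 - (x 0 * x 1) ^ 6)) r.domain → ∃ (a b c : ℚ) (r' : Literature.NumberTheory.Transcendental.KZ.IntegralRep 2), r'.domain = {x | ∀ i, x i ∈ Set.Ioo (0:ℝ) 1} ∧ Set.EqOn r'.integrand (fun x => (a : ℝ) + b / (1 - x 0 * x 1) + c / (1 + x 0 * x 1 + (x 0 * x 1) ^ 2))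 r'.domain ∧ Literature.NumberTheory.Transcendental.KZ.Equivalent r r'

/-- item stmt-KontsevichZagierPeriods-3872 · crux · rank 4 · closed · proved by Summit.KontsevichZagierPeriods.HurwitzMicroSectors.DilationMove.DilationMove_of @ 7013b04e1aff (prover) · by planner
why it might fail: only as typed: r'.domain = Φ '' r.domain needs Φ''(0,1)ⁿ = (0,1)ⁿ exactly, the Fréchet derivative within the box must be the diagonal CLM whose `.det` is m^n ∏ x_i^(m−1) (truncated `m - 1`, m = 1 ⇒ identity), and |det| = det needs positivity on the open box.
sources: KontsevichZagier2001, Milnor1983, BCR1998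
[crux] (card N1, the engine, any dimension n, any m ≥ 1) for reps r, r' on the open unit box (0,1)ⁿ
with r.integrand x = r'.integrand (x_i^m)_i · m^n ∏_i x_i^(m−1) on the box, [r] − [r'] is ONE
change-of-variables move (Φ x = (x_i^m)_i: polynomial hence ℚ-semialgebraic, injective with image
the box, derivative diag(m x_i^(m−1)) with determinant m^n ∏ x_i^(m−1) > 0). This realises every
Hurwitz distribution relation Σ_(j<m) ζ(w,(a+j)/m)-type identity inside rule 2). [difficulty: M] -/
@[route_item "route-KontsevichZagierPeriods-HurwitzMicroSectors", crux]
def DilationMove : Prop :=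
  ∀ (n m : ℕ), 1 ≤ m → ∀ (r r' : Literature.NumberTheory.Transcendental.KZ.IntegralRep n), r.domain = {x | ∀ i, x i ∈ Set.Ioo (0:ℝ) 1} → r'.domain = {x | ∀ i, x i ∈ Set.Ioo (0:ℝ) 1} → (∀ x ∈ r.domain, r.integrand x = r'.integrand (fun i => x i ^ m) * ((m : ℝ) ^ n * ∏ i, x i ^ (m - 1))) → Literature.NumberTheory.Transcendental.KZ.of r - Literature.NumberTheory.Transcendental.KZ.of r' ∈ Literature.NumberTheory.Transcendental.KZ.changeOfVariablesRel

/-- item stmt-KontsevichZagierPeriods-3873 · crux · rank 5 · closed · proved by Summit.KontsevichZagierPeriods.Theorems.AperySectorThreeTwo.AperySectorThreeTwo_of (prover) · by planner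
why it might fail: ∫(0,1)³ 1/(1−xyz) must be identified with zetaValue 3 = Σ' 1/n³ (tsum from n = 0, junk 1/0 = 0) exactly; polynomial parts leave dimension 3 (Newton–Leibniz thrice to a point and back) with integrable semialgebraic intermediates — a side-condition slip falsifies the ∀ as typed.
sources: Apery1979, KontsevichZagier2001, Milnor1983, BeukersCalabiKolk1993
[crux] (card N4, weight-3 calibration, UNCONDITIONAL) Conjecture 1 holds for every pair of reps on
the open box (0,1)³ with integrands P(xyz)/(1−(xyz)²), P'(xyz)/(1−(xyz)²), P, P' ∈ ℚ[t]: values lie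
in ℚ + ℚζ(3) (h₀ = Σ1/(2j+1)³ = 7ζ(3)/8, h₁ = ζ(3)/8), normal forms a + b/(1−xyz); reduction = ONE
dilation (m = 2, n = 3: [1/(1−t)] ∼ [8t/(1−t²)], i.e. H₀ + H₁ ∼ 8H₁) + polynomial parts; rigidity =
ζ(3) ∉ ℚ, which is PROVED in tree
(Literature.NumberTheory.Transcendental.irrational_zetaValue_three_holds), so no hypothesis is
carried. [deps: DilationMove] [difficulty: L] -/
@[route_item "route-KontsevichZagierPeriods-HurwitzMicroSectors"]
def AperySectorThreeTwo : Prop :=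
  ∀ (r r' : Literature.NumberTheory.Transcendental.KZ.IntegralRep 3) (P P' : Polynomial ℚ), r.domain = {x | ∀ i, x i ∈ Set.Ioo (0:ℝ) 1} → r'.domain = {x | ∀ i, x i ∈ Set.Ioo (0:ℝ) 1} → Set.EqOn r.integrand (fun x => Polynomial.aeval (x 0 * x 1 * x 2) P / (1 - (x 0 * x 1 * x 2) ^ 2)) r.domain → Set.EqOn r'.integrand (fun x => Polynomial.aeval (x 0 * x 1 * x 2) P' / (1 - (x 0 * x 1 * x 2) ^ 2)) r'.domain → r.value = r'.value → Literature.NumberTheory.Transcendental.KZ.Equivalent r r'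

/-- item stmt-KontsevichZagierPeriods-14341 · crux (kind.auto-crux: conjecture-grade) · rank 9 · open · by planner
why it might fail: summit-strength: false iff Conjecture 1 for the fixed H21 calculus fails OFF the (2,6)/(3,2) box sectors — e.g. an additive invariant of FormalRep/relations separating two equal-valued rational reps (route Neg's bets: Γ-detours, regularised MZV relations, transcendental primitives).
sources: KontsevichZagier2001, HuberMullerStach2017, CalegariDimitrovTang2024
[support] NOT CLAIMED — the summit-strength remainder of Conjecture 1 outside this route's closed
sectors, concluding the route's target BY NAME: SectorTwoSix → AperySectorThreeTwo →
NormalFormPrinciple. Filed (operator hold 2026-08-16, route.target-unreachable, option (a)) only so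
that an item concludes the target in the item graph; it is EQUIVALENT to the Statement given the
sectors (NormalFormPrinciple ↔ KontsevichZagierPeriods: `closes` in this file and
`normalFormPrinciple_of_statement` in the planner's Sketch.lean, both sorry-free), and the Statement
implies this item (`hurwitzSectorComplement_of_statement`, Sketch.lean), so it is not stronger than
the summit and cannot be refuted short of refuting Conjecture 1 for the H21 calculus. Nobody is
expected to prove it except by proving Conjecture 1 off the sectors; it is NOT staffed by this
route's mechanism (dilations = distribution relations + one linear-independence theorem close one
(weight, level) rung at a time; the rung table is open-ended by design). It is the SPLICE POINT
where further rungs attach by glued splits when their independence input exists — (2,4) ⟸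
Indep(1,π²,G) (CatalanSectorTwoFour, conditional), (4,6) ⟸ Ind -/
@[route_item "route-KontsevichZagierPeriods-HurwitzMicroSectors"]
def HurwitzSectorComplement : Prop :=
  SectorTwoSix → AperySectorThreeTwo → NormalFormPrinciple

/-- item stmt-KontsevichZagierPeriods-0541 · support · rank 6 · open · by planner
PiLocalKernel := ∀ c : Literature.NumberTheory.Transcendental.KZ.FormalRep,
Literature.NumberTheory.Transcendental.KZ.eval c = 0 → ∃ N : ℕ, (of piRep)^⋆N ⋆ c ∈
Literature.NumberTheory.Transcendental.KZ.relations. This is the half of S reachable by torsor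
arguments: Grothendieck's period conjecture gives injectivity of P̃ = P̃^eff[(2πi)⁻¹] → ℂ (route
Grothendieck, 0279), and a transfer of Nori/cohomological relators into KZ.relations (route
NoriTransfer, 0194/0198) then yields (2πi)^{2N}·c = (−4π²)^N·c ∈ relations WITHOUT needing
injectivity of P̃^eff → P̃; Ayoub's rigid-analytic computation of the Betti–de Rham torsor
(Ayoub2015 §3.6, AyoubRelKZRevisited Thm 1.11) is the model argument and works precisely after
inverting 2πi. Open (≈ GPC-strength); filed so that provers/refuters see the effective/localised
distinction explicitly and so that a proof of #2′ collapses the problem to this item.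
[needs_definition: KZ.prodRep / piRep / PiLocalKernel (def request this session); sources:
AyoubRelKZRevisited, Ayoub2015, HuberMullerStach2017] -/
@[route_item "route-KontsevichZagierPeriods-HurwitzMicroSectors"]
def AyoubPiLocalKernel : Prop :=
  ∀ (P : ∀ n : ℕ, Literature.NumberTheory.Transcendental.KZ.IntegralRep n → Literature.NumberTheory.Transcendental.KZ.IntegralRep (n + 2)), (∀ (n : ℕ) (r : Literature.NumberTheory.Transcendental.KZ.IntegralRep n), (P n r).domain = {z : Fin (n + 2) → ℝ | z 0 ^ 2 + z 1 ^ 2 ≤ 1 ∧ (fun i : Fin n => z i.succ.succ) ∈ r.domain} ∧ (P n r).integrand = fun z => r.integrand (fun i : Fin n => z i.succ.succ)) → ∀ c : Literature.NumberTheory.Transcendental.KZ.FormalRep, Literature.NumberTheory.Transcendental.KZ.eval c = 0 → ∃ N : ℕ, (⇑(FreeAbelianGroup.lift (fun s : (Σ n, Literature.NumberTheory.Transcendental.KZ.IntegralRep n) => Literature.NumberTheory.Transcendental.KZ.of (P s.1 s.2))))^[N] c ∈ Literature.NumberTheory.Transcendental.KZ.relations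

/-- item stmt-KontsevichZagierPeriods-0540 · support · rank 9 · open · by planner
why it might fail: A certificate for [π]⋆c may mix the two disc coordinates with c's (carrier migration), leaving no shadow certificate for c; the motivic shadow P̃(MM^eff_Nori) → P̃(MM_Nori) injective is printed OPEN (HuberWustholz2022 App. A p. 200); one witness refutes the summit.
sources: HuberWustholz2022, AyoubRelKZRevisited, KontsevichZagier2001, HuberMullerStachPeriods2017
PiCancellation := ∀ c : Literature.NumberTheory.Transcendental.KZ.FormalRep, (of piRep) ⋆ c ∈
Literature.NumberTheory.Transcendental.KZ.relations → c ∈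
Literature.NumberTheory.Transcendental.KZ.relations, piRep = closed unit disc with integrand 1 (d =
2). A consequence of S (eval (piRep ⋆ c) = π · eval c by Fubini, π ≠ 0), but transcendence-free: it
is a regular-element property of the presented abelian group FormalRep/relations under the product,
and the exact point where Ayoub's relative theorem fails to be effective (AyoubRelKZRevisited Rem
1.3: the torsor exists only over D((2πi)⁻¹)) and where HuberMullerStach2017 §13 passes from P^eff to
P = P^eff[(2πi)⁻¹]. Independent of the chosen π-representation once `relations` is an ideal under ⋆
(part of the def request). Attack suggestions: (i) normal forms for ⋆-multiples of disc reps (the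
disc factor occupies two leading coordinates untouched by NL along the last coordinate; CoV may mix
them — the crux is whether a relation certificate for piRep ⋆ c can be 'projected' to one for c,
e.g. by restricting/fibrewise-specialising the disc coordinates at a rational point and using domain
additivity); (ii) small cases: c supported in dimensi -/
@[route_item "route-KontsevichZagierPeriods-HurwitzMicroSectors"]
def AyoubPiCancellation : Prop :=
  ∀ (P : ∀ n : ℕ, Literature.NumberTheory.Transcendental.KZ.IntegralRep n → Literature.NumberTheory.Transcendental.KZ.IntegralRep (n + 2)), (∀ (n : ℕ) (r : Literature.NumberTheory.Transcendental.KZ.IntegralRep n), (P n r).domain = {z : Fin (n + 2) → ℝ | z 0 ^ 2 + z 1 ^ 2 ≤ 1 ∧ (fun i : Fin n => z i.succ.succ) ∈ r.domain} ∧ (P n r).integrand = fun z => r.integrand (fun i : Fin n => z i.succ.succ)) → ∀ c : Literature.NumberTheory.Transcendental.KZ.FormalRep, FreeAbelianGroup.lift (fun s : (Σ n, Literature.NumberTheory.Transcendental.KZ.IntegralRep n) => Literature.NumberTheory.Transcendental.KZ.of (P s.1 s.2)) c ∈ Literature.NumberTheory.Transcendental.KZ.relations → c ∈ Literature.Numb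erTheory.Transcendental.KZ.relations

/-- item stmt-KontsevichZagierPeriods-15289 · support · rank 9 · closed · proved by Summit.KontsevichZagierPeriods.HurwitzMicroSectors.NormalFormPrincipleSplitGlue.normalFormPrincipleSplitGlue_proof @ 33d6bf2ebff5 (prover) · by planner
sources: KontsevichZagier2001, Ayoub2014, HuberWustholz2022
[support] STRATEGIST'S DECOMPOSITION of the crux NormalFormPrinciple (stmt-3869) along [π] — the
glue NormalFormPrincipleSplitGlue : AyoubPiLocalKernel → AyoubPiCancellation → NormalFormPrinciple.
PROVABLE NOW and PROVED against the tree (strategist's Split.lean, attached as evidence on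
stmt-KontsevichZagierPeriods-3869: `NormalFormPrinciple_of_subs`, hypotheses typed verbatim as the
two children = items 0541/0540, rc 0, 0 sorries, axioms standard; a planner seat cannot land
Theorems files (perm.theorems-prover-only), so any prover may copy it to
Theorems/HurwitzMicroSectorsNormalFormPrincipleSplit.lean). Proof: `AyoubSpecialisation.closes h₂ h₃
: KontsevichZagierPeriods` (pinned product built inline, π-peeling by induction on N) then
`PiBox.normalFormPrinciple_of_statement` (𝒩 := the rational representations). The split is EXACT:
NormalFormPrinciple ↔ AyoubPiLocalKernel ∧ AyoubPiCancellation (`normalFormPrinciple_iff_subs`, same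
file; closed-term form landed as `normalFormPrinciple_iff_piLocalKernel_and_piCancellation`,
p103528). -/
@[route_item "route-KontsevichZagierPeriods-HurwitzMicroSectors"]
def NormalFormPrincipleSplitGlue : Prop :=
  AyoubPiLocalKernel → AyoubPiCancellation → NormalFormPrinciple

/-- item stmt-KontsevichZagierPeriods-3874 · support · rank 9 · closed · proved by Summit.KontsevichZagierPeriods.Theorems.HurwitzMicroSectorsRigidityTwoSix.rigidityTwoSix_proof @ b1410290bb74 (prover) · by planner
sources: CalegariDimitrovTang2024, KontsevichZagier2001
[support] (card N3, rigidity half) under CDT's Theorem 1, two normal forms a + b/(1−xy) +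
c/(1+xy+x²y²) and a' + b'/(1−xy) + c'/(1+xy+x²y²) on the open box with equal values have (a,b,c) =
(a',b',c'): value = a + bπ²/6 + cL(2,χ₋₃) by BoxIntegralZetaTwo / BoxIntegralLTwoChiThree (box has
volume 1), then linear independence compares coefficients. [difficulty: provable-now] -/
@[route_item "route-KontsevichZagierPeriods-HurwitzMicroSectors"]
def RigidityTwoSix : Prop :=
  LinearIndependent ℚ ![(1 : ℝ), Real.pi ^ 2, (∑' n : ℕ, (1 / (3 * (n : ℝ) + 1) ^ 2 - 1 / (3 * (n : ℝ) + 2) ^ 2))] → ∀ (a b c a' b' c' : ℚ) (r r' : Literature.NumberTheory.Transcendental.KZ.IntegralRep 2), r.domain = {x | ∀ i, x i ∈ Set.Ioo (0:ℝ) 1} → Set.EqOn r.integrand (fun x => (a : ℝ) + b / (1 - x 0 * x 1) + c / (1 + x 0 * x 1 + (x 0 * x 1) ^ 2)) r.domain → r'.domain = {x | ∀ i, x i ∈ Set.Ioo (0:ℝ) 1} → Set.EqOn r'.integrand (fun x => (a' : ℝ) + b' / (1 - x 0 * x 1) + c' / (1 + x 0 * x 1 + (x 0 * x 1) ^ 2))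 r'.domain → r.value = r'.value → a = a' ∧ b = b' ∧ c = c'

/-- item stmt-KontsevichZagierPeriods-3875 · support · rank 9 · closed · proved by Summit.KontsevichZagierPeriods.HurwitzMicroSectors.BoxIntegralZetaTwo.boxIntegralZetaTwo_proof (prover) · by planner
sources: KontsevichZagier2001, BeukersCalabiKolk1993
[support] KZ's own example: 1/(1−xy) is integrable on the open unit box and ∫∫ dxdy/(1−xy) = π²/6
(expand the geometric series, Tonelli, Σ 1/(k+1)² = π²/6 via Mathlib hasSum_zeta_two). [difficulty:
provable-now] -/
@[route_item "route-KontsevichZagierPeriods-HurwitzMicroSectors"]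
def BoxIntegralZetaTwo : Prop :=
  MeasureTheory.IntegrableOn (fun x : Fin 2 → ℝ => 1 / (1 - x 0 * x 1)) {x | ∀ i, x i ∈ Set.Ioo (0:ℝ) 1} ∧ ∫ x in {x : Fin 2 → ℝ | ∀ i, x i ∈ Set.Ioo (0:ℝ) 1}, 1 / (1 - x 0 * x 1) = Real.pi ^ 2 / 6

/-- item stmt-KontsevichZagierPeriods-3876 · support · rank 9 · closed · proved by Summit.KontsevichZagierPeriods.Theorems.boxIntegralLTwoChiThree_proof @ b1410290bb74 (prover) · by planner
sources: CalegariDimitrovTang2024, KontsevichZagier2001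
[support] 1/(1+xy+x²y²) = (1−t)/(1−t³) is integrable on the open unit box and ∫∫ = Σ_(n≥0)(1/(3n+1)²
− 1/(3n+2)²) = L(2,χ₋₃) = 0.7813024128964862968… (CDT p. 3 prints the equivalent ∬_(1≥y≥x≥0)
dxdy/(y(1+x+x²))). [difficulty: provable-now] -/
@[route_item "route-KontsevichZagierPeriods-HurwitzMicroSectors"]
def BoxIntegralLTwoChiThree : Prop :=
  MeasureTheory.IntegrableOn (fun x : Fin 2 → ℝ => 1 / (1 + x 0 * x 1 + (x 0 * x 1) ^ 2)) {x | ∀ i, x i ∈ Set.Ioo (0:ℝ) 1} ∧ ∫ x in {x : Fin 2 → ℝ | ∀ i, x i ∈ Set.Ioo (0:ℝ) 1}, 1 / (1 + x 0 * x 1 + (x 0 * x 1) ^ 2) = ∑' n : ℕ, (1 / (3 * (n : ℝ) + 1) ^ 2 - 1 / (3 * (n : ℝ) + 2) ^ 2)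

/-- item stmt-KontsevichZagierPeriods-3877 · support · rank 9 · closed · proved by Summit.KontsevichZagierPeriods.Theorems.HurwitzMicroSectorsCatalanSectorTwoFour.catalanSectorTwoFour_proof (prover) · by planner
sources: Milnor1983, Lang1990, KontsevichZagier2001, CalegariDimitrovTang2024
[support] (card N4, the next rung, CONDITIONAL on an OPEN hypothesis) if 1, π², G = Σ(−1)ⁿ/(2n+1)²
are ℚ-linearly independent then Conjecture 1 holds on the level-4 weight-2 box sector
P(xy)/(1−(xy)⁴): values in ℚ + ℚπ² + ℚG (G = ∫∫dxdy/(1+x²y²) = h₀ − h₂), normal forms a + b/(1−xy) +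
c/(1+x²y²), reduction by ONE dilation m = 2 (H₁ ∼ 3H₃, H₀ + H₂ ∼ 12H₃). The implication is provable
now with the same engine; the hypothesis (irrationality of Catalan's constant and more) is open,
which is the card's point: on this rung Conjecture 1 costs exactly Indep(1, π², G). [difficulty: M] -/
@[route_item "route-KontsevichZagierPeriods-HurwitzMicroSectors"]
def CatalanSectorTwoFour : Prop :=
  LinearIndependent ℚ ![(1 : ℝ), Real.pi ^ 2, (∑' n : ℕ, (-1 : ℝ) ^ n / (2 * (n : ℝ) + 1) ^ 2)] → ∀ (r r' : Literature.NumberTheory.Transcendental.KZ.IntegralRep 2) (P P' : Polynomial ℚ), r.domain = {x | ∀ i, x i ∈ Set.Ioo (0:ℝ) 1} → r'.domain = {x | ∀ i, x i ∈ Set.Ioo (0:ℝ) 1} → Set.EqOn r.integrand (fun x => Polynomial.aeval (x 0 * x 1) P / (1 - (x 0 * x 1) ^ 4)) r.domain → Set.EqOn r'.integrand (fun x => Polynomial.aeval (x 0 * x 1) P' / (1 - (x 0 * x 1) ^ 4)) r'.domain → r.value = r'.value → Literature.NumberTheory.Transcendental.KZ.Equivalent r r'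

/-- item stmt-KontsevichZagierPeriods-3878 · assembly · rank 1 · closed · proved by Summit.KontsevichZagierPeriods.Theorems.HurwitzMicroSectorsAssembly.assembly_proof @ cf29ad9b5131 (prover) · by planner
sources: KontsevichZagier2001
[assembly] NormalFormPrinciple → KontsevichZagierPeriods. -/
@[route_item "route-KontsevichZagierPeriods-HurwitzMicroSectors"]
def Assembly : Prop :=
  NormalFormPrinciple → KontsevichZagierPeriods

/-! D-0027 §2.1 — DECIDING THEOREM (planner-authored via `route open/edit --closes-file`; by planner-rbadge-KontsevichZagierPeriods-Hurwitz-6f39514d-g2-0 2026-08-15T16:11:15Z):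
its hypotheses are this route's items and its conclusion the sub-problem Statement (glue_lint), and it elaborates with this file. -/

@[closes "route-KontsevichZagierPeriods-HurwitzMicroSectors"] theorem closes (h : NormalFormPrinciple) : KontsevichZagierPeriods := by
  obtain ⟨𝒩, hrig, hred⟩ := h
  intro n m r r' hr hr' hv
  obtain ⟨k, N, hN, hrN⟩ := hred n r hr
  obtain ⟨k', N', hN', hrN'⟩ := hred m r' hr'
  have h1 : r.value = N.value :=
    Literature.NumberTheory.Transcendental.KZ.Equivalent.value_eq_holds hrN
  have h2 : r'.value = N'.value :=
    Literature.NumberTheory.Transcendental.KZ.Equivalent.value_eq_holds hrN'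
  have hvN : N.value = N'.value := by rw [← h1, ← h2, hv]
  exact (hrN.trans (hrig k k' N N' hN hN' hvN)).trans hrN'.symm

end Summit.KontsevichZagierPeriods.KontsevichZagierPeriods.Theses.HurwitzMicroSectors
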